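import Summits.ResolutionOfSingularities.ResolutionOfSingularities.Theorems.MarkedTransferCampaignW46TameInduction
import Summits.ResolutionOfSingularities.ResolutionOfSingularities.Theorems.MarkedTransferCampaignW46ThreefoldsRegime
import Summits.ResolutionOfSingularities.ResolutionOfSingularities.Theorems.MarkedTransferCampaignW46CuspStaircaseExitBound
import Literature.AlgebraicGeometry.Resolution.RegularCentreBlowupOrder
import HarnessLib

/-!
# [OURS · L1 W4.6, rung (iv) «large characteristic», LEVEL 1] The tame level-0 package PERSISTS along every run of the
# TYPED procedure in regime (iv): maximal order, the regime, and hence local maximal contact + going up at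
# every stage of EVERY run (cell res-hironaka, LADDER-RESOLUTION rung L, D-0089; slot W4.6, seat res-L1-s46-pv-7; host route
# MarkedTransfer, `--supports stmt-ResolutionOfSingularities-16155 --as helper`)

HONEST FRAMING. Nothing here is a statement of H. Hironaka's manuscript (2017-03-23, [Hironaka2017]) and nothing here
asserts that any statement of it holds. OURS corollaries over the shared typed-procedure module
`MarkedTransferCampaignW46TypedProcedure` (res-L1-type-o1: `Step`, `Step.E'`, `Run`, `Regime.charGT`; typed CANDIDATE
carriers `AmbientDatum`, `IdealExponent`, `IdealExponent.sing`, `IdealExponent.transform` (Def. 2.1, controlled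
transform) used as definitions) of TREE theorems: Cossart–Piltant 2008 Prop. 4.2 (a) (the maximal order does not increase
under a permissible blowing up, `IsBlowup.idealOrder_controlledTransform_le_of_forall`, every characteristic) and this
seat's tame Kollár package (`TameInduction.goingUp_nhd_of_charGT`, p529145; Kollár Thm. 3.80 / Cor. 3.85 for `b < p`);
bookkeeping from the sibling files `…ThreefoldsRegime` (res-L1-s46-pv-3: `ambientZ_std`, `IsCentre.isRegular_subscheme`,
`Step.le_idealOrder_of_mem`) and `…CuspStaircaseExitBound` (res-L1-s46-pv-5: `Run.b_eq`).
No premise of the manuscript, no FACT-LIST premise. AI review is weaker than expert review. No `sorry`, no new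
definition; axioms standard.

## What this file pins

* `Step.idealOrder_E'_le` — for ONE typed step `s` from `(A, E, R)` (its centre `D ⊆ ∇(E) ⊆ Sing(E)` is permissible
  for `E` and regular: `IsCentre.isPermissibleCentre`, `IsCentre.isRegular_subscheme` of the sibling files) and
  `E = (J, b)` of maximal order `b` (`ord_ξ J ≤ b` everywhere): the transform `E' = (J', b)` (typed `Step.E'`, Def. 2.1)
  is again of maximal order `b` on `Z'` — characteristic-free (Cossart–Piltant);
* `Step.charGT_E'` — every step preserves every regime `Regime.charGT n f` (the exponent `b` is unchanged);
* `Run.idealOrder_le`, `Run.charGT` — along an infinite typed `Run` (`Run.b_eq` of the sibling files: `b` is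
  constant), maximal order `b` persists from stage `0` to every stage, and so does the regime;
* `Run.goingUp_nhd` — hence, **in regime (iv) over a perfect field, at EVERY stage `k` of such a run and at every point
  of `Z_k`, the tame package of this seat holds**: a local maximal-contact hypersurface ideal `H` (regular,
  `Sing(E_k) ∩ U ⊆ V(H)`, `Kollar2007.IsMaxContact (J_k|_U) b H`) with the going-up property (every resolution of the
  restricted coefficient marked ideal `(V(H), 𝒞(J_k|_U, b)|_{V(H)}, ∅, b!)` pushes forward to a resolution of
  `(U, J_k|_U, ∅, b)`). The characteristic-zero induction frame is available all along the run; what it does NOT give is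
  a decreasing measure (termination), which in characteristic zero comes from the induction hypothesis in dimension
  `n − 1` applied to marked ideals of marking `b!` — outside the tame range whenever `p ≤ b!`
  (`TameInduction.nextLevel_not_tame_of_le_factorial`).

## References (context; nothing is cited as a premise)

* V. Cossart, O. Piltant, J. Algebra 320 (2008), proof of Prop. 4.2 (a) — through the tree's
  `RegularCentreBlowupOrder.lean`. [cite: CossartPiltant2008, proof of Prop. 4.2 (a)]
* J. Kollár, *Lectures on Resolution of Singularities* (2007), Thm. 3.80, Cor. 3.85, 3.104 Step 2.2 — through this seat's
  `KollarMaximalContactTame.lean`, `KollarGoingUpTame.lean`. [cite: Kollar2007, 3.104 Step 2.2]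
-/

noncomputable section

set_option linter.dupNamespace false -- mandated namespace of this single-conjunct summit

open CategoryTheory AlgebraicGeometry TopologicalSpace IsLocalRing

namespace Summit.ResolutionOfSingularities.ResolutionOfSingularities.Theorems
namespace CampaignW46

open Literature.AlgebraicGeometry.Resolution
open Literature.AlgebraicGeometry.Hironaka2017.S02Preliminaries
open Scheme.IdealSheafData

universe u

variable {n : ℕ} {p : ℕ} [Fact p.Prime] {K : Type u} [Field K] [CharP K p]
variable {N : Notions.{u} n}

/-! ## One step -/

namespace Step

variable {A A' : AmbientDatum p K} {E : IdealExponent A.Z} {R : Resume N A E} (s : Step R A')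

/-- [OURS · L1 W4.6 (iv)] The exponent is unchanged by a step: `E'.b = E.b` (Def. 2.1). [folklore] -/
theorem E'_b : s.E'.b = E.b := rfl

/-- [OURS · L1 W4.6 (iv)] The ideal of the transform is the controlled transform of `J` along the blow-up of the centre
(Def. 2.1, tree `controlledTransform`). [folklore] -/
theorem E'_J : s.E'.J = controlledTransform s.π (vanishingIdeal s.D) E.J E.b := rfl

/-- [OURS · L1 W4.6 (iv); NOT a statement of the manuscript] **Maximal order persists under a typed step**
(Cossart–Piltant 2008, Prop. 4.2 (a), every characteristic): the centre `D` of the step `s` lies in `Sing(E)`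
(`Step.le_idealOrder_of_mem`) and is regular; so if `E = (J, b)` has `ord_ξ J ≤ b` at every point of `Z`, then the
transform `E' = (J', b)` satisfies `ord_{ξ'} J' ≤ b` at every point of `Z'`. [cite: CossartPiltant2008, proof of Prop. 4.2 (a)] -/
theorem idealOrder_E'_le (hmax : ∀ ξ : A.Z, idealOrder E.J ξ ≤ E.b) (ξ' : A'.Z) :
    idealOrder s.E'.J ξ' ≤ s.E'.b := by
  haveI := (ambientZ_std A).1
  haveI := (ambientZ_std A').1
  have hY : ∀ y ∈ (s.D : Set A.Z), idealOrder E.J y = E.b :=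
    fun y hy => le_antisymm (hmax y) (s.le_idealOrder_of_mem hy)
  exact s.blowup.idealOrder_controlledTransform_le_of_forall (ambientZ_std A).2.1 s.centre.isRegular_subscheme hY
    hmax ξ'

/-- [OURS · L1 W4.6 (iv)] Every step preserves every large-characteristic regime `Regime.charGT n f` (the exponent is
unchanged). [folklore] -/
theorem charGT_E' {f : ℕ → ℕ → ℕ} (hE : Regime.charGT (p := p) (K := K) n f A E) :
    Regime.charGT (p := p) (K := K) n f A' s.E' :=
  hE

end Step

/-! ## Along an infinite run with permissible centres -/

namespace Run

variable {Rd : Reading p K N} (r : Run N Rd)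

/-- [OURS · L1 W4.6 (iv); NOT a statement of the manuscript] **Maximal order persists along every typed run**: if
`E_0 = (J_0, b)` has `ord ≤ b` everywhere, then every `E_k = (J_k, b)` has `ord ≤ b` everywhere on `Z_k`.
[cite: CossartPiltant2008, proof of Prop. 4.2 (a)] -/
theorem idealOrder_le (hmax : ∀ ξ : (r.A 0).Z, idealOrder (r.E 0).J ξ ≤ (r.E 0).b) (k : ℕ)
    (ξ : (r.A k).Z) : idealOrder (r.E k).J ξ ≤ (r.E k).b := by
  induction k with
  | zero => exact hmax ξ
  | succ k ih =>
    rw [r.E_succ k]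
    exact (r.step k).idealOrder_E'_le ih _

/-- [OURS · L1 W4.6 (iv)] The regime persists along every run: `Regime.charGT n f` at stage `0` implies it at every
stage. [folklore] -/
theorem charGT {f : ℕ → ℕ → ℕ} (h0 : Regime.charGT (p := p) (K := K) n f (r.A 0) (r.E 0)) (k : ℕ) :
    Regime.charGT (p := p) (K := K) n f (r.A k) (r.E k) := by
  change f n (r.E k).b < p
  rw [r.b_eq k]
  exact h0

/-- [OURS · L1 W4.6 (iv); NOT a statement of the manuscript] **The tame package at every stage of a run in regime (iv).**
Over a perfect field `K` of characteristic `p`: for every typed run `r` starting in regime (iv) (`b < p`) at a state `E_0 = (J_0, b)` of maximal order `b ≥ 1`, at EVERY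
stage `k` and every point `ξ ∈ Z_k` there are an open `U ∋ ξ` and an ideal sheaf `H` on `U` of a regular hypersurface
with `Sing(E_k) ∩ U ⊆ V(H)`, which is a hypersurface of maximal contact for `(J_k|_U, b)` (`Kollar2007.IsMaxContact`)
and has the going-up property (every resolution of `(V(H), 𝒞(J_k|_U, b)|_{V(H)}, ∅, b!)` pushes forward to a
resolution of `(U, J_k|_U, ∅, b)`). [cite: Kollar2007, 3.104 Step 2.2, Thm. 3.80, Cor. 3.85] -/
theorem goingUp_nhd [PerfectField K] (h0 : Regime.charGT (p := p) (K := K) n (fun _ b => b) (r.A 0) (r.E 0)) (hb : 1 ≤ (r.E 0).b)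
    (hmax : ∀ ξ : (r.A 0).Z, idealOrder (r.E 0).J ξ ≤ (r.E 0).b) (k : ℕ) (ξ : (r.A k).Z) :
    letI : (r.A k).Z.Over (Spec (.of K)) := ⟨(r.A k).hom⟩
    ∃ (U : (r.A k).Z.Opens) (_ : ξ ∈ U) (H : (U : Scheme.{u}).IdealSheafData),
      (∀ y ∈ H.support, ∃ v : (U : Scheme.{u}).presheaf.stalk y,
          stalkIdeal H y = Ideal.span {v} ∧ v ∉ (maximalIdeal ((U : Scheme.{u}).presheaf.stalk y)) ^ 2) ∧
        (∀ y : (U : Scheme.{u}), y.1 ∈ (r.E k).sing → y ∈ H.support) ∧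
        Kollar2007.IsMaxContact ((r.E k).J.comap U.ι) (r.E k).b H ∧
        ∀ (_ : DecidableEq (U : Scheme.{u}).IdealSheafData) (t : CentreSeq H.subscheme),
          t.IsResolutionOf
              ((⟨(r.E k).J.comap U.ι, [], (r.E k).b⟩ : MarkedIdeal (U : Scheme.{u})).coeffRestrict
                (overHom K (U : Scheme.{u})) H) →
            (t.pushforward H.subschemeι).IsResolutionOf ⟨(r.E k).J.comap U.ι, [], (r.E k).b⟩ :=
  TameInduction.goingUp_nhd_of_charGT (r.A k) (r.E k) (r.charGT h0 k) (by rw [r.b_eq k]; exact hb)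
    (r.idealOrder_le hmax k) ξ

end Run

end CampaignW46
end Summit.ResolutionOfSingularities.ResolutionOfSingularities.Theorems

end
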